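import Summits.SmoothPoincare4.SmoothPoincare4.Theorems.SullivanDualWitnessChargeV18AssemblyFacts
import Summits.SmoothPoincare4.SmoothPoincare4.Theorems.SullivanDualWitnessChargeReductionV16
import Literature.Geometry.Symplectic.AdjunctionEmbeddedSpheres
import Literature.Topology.FourManifolds.HomotopyS4OrientableProofs

/-!
# Crux `WitnessCharge`, reduction v18: the crux from `{HLS, normal-witness transfer}` (lead c9)

With McDuff's no-cusp theorem F5 discharged in Literature
(`jHolomorphic_immersed_of_limitEmbedded_punctured_holds`) and the v18 assembly
`helper_witnessCharge_of_hls_nwtJ : hls → C2J → WitnessCharge` (`…V18AssemblyFacts.lean`), the crux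
`WitnessCharge` (stmt-SmoothPoincare4-7824) now rests on exactly two inputs:

* the Hofer–Lizan–Sikorav local foliation `hls_localFoliation_embeddedSphere_trivialNormal`
  (= route item `LocalFoliationEmbeddedSpheres`, stmt-SmoothPoincare4-16778), and
* the `J`-decorated normal-witness transfer `C2J`, which follows trivially from EITHER the route item
  `NormalWitnessTransfer` (stmt-SmoothPoincare4-18059: the same statement without the four
  `J`-holomorphy hypotheses — classical differential topology, no `J`-curve theory) OR the crux
  `AdjunctionEmbeddedSpheres` (stmt-SmoothPoincare4-16775 = Literature
  `adjunction_embedded_of_somewhereInjective_sphere`, which only asks `C` somewhere injective).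

Contents: `helper_nwtJ_of_normalWitnessTransfer`, `helper_nwtJ_of_adjunction` (the two trivial
implications), `helper_witnessCharge_of_hls_nwt : LocalFoliationEmbeddedSpheres → NormalWitnessTransfer →
WitnessCharge` (registered helper), `helper_witnessCharge_of_hls_adj` (v16 with F5 discharged), and the
same corollaries for the sibling support item `PencilLocalFamily` (stmt-16772), which prove the glue
items `PencilLocalFamilyOfNormalTransfer` (18051) and `Assembly2` (18038) in their own files.
-/

noncomputable section

set_option linter.dupNamespace false

open scoped Manifold ContDiff Topology
open Set Filter Function Literature.Geometry.Symplectic Literature.Topology.FourManifolds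
  Literature.Topology.FourManifolds.ComplexProjectiveSpace

namespace Summit.SmoothPoincare4.SmoothPoincare4.Theorems.WitnessCharge.PencilIncompleteness

/-- **`C2J` from the route item `NormalWitnessTransfer`** (drop the four `J`-holomorphy
hypotheses). -/
theorem helper_nwtJ_of_normalWitnessTransfer
    (hN : Summit.SmoothPoincare4.SmoothPoincare4.Theses.SullivanDual.NormalWitnessTransfer) :
    ∀ (X : Type) [TopologicalSpace X] [T2Space X] [SecondCountableTopology X]
      [ChartedSpace (EuclideanSpace ℝ (Fin 4)) X] [IsManifold (𝓡 4) ∞ X]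
      (JX : AlmostComplexStructure (𝓡 4) ∞ X) (u₀ v₀ : ℂ → X) (N : Set X) (π : X → ℂ)
      (u v : ℂ → X) (F F₀ : C(ComplexProjectiveSpace 1, X)),
      ContMDiff 𝓘(ℝ, ℂ) (𝓡 4) ∞ u₀ → ContMDiff 𝓘(ℝ, ℂ) (𝓡 4) ∞ v₀ → (∀ z : ℂ, z ≠ 0 → v₀ z = u₀ z⁻¹) →
      IsJHolomorphic (𝓡 4) (fun y => JX y) u₀ → IsJHolomorphic (𝓡 4) (fun y => JX y) v₀ →
      Injective u₀ → (∀ z, Injective (mfderiv 𝓘(ℝ, ℂ) (𝓡 4) u₀ z)) →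
      Injective (mfderiv 𝓘(ℝ, ℂ) (𝓡 4) v₀ 0) → v₀ 0 ∉ range u₀ →
      IsOpen N → range u₀ ∪ {v₀ 0} ⊆ N → ContMDiffOn (𝓡 4) 𝓘(ℝ, ℂ) ∞ π N →
      (∀ y ∈ N, Surjective (mfderiv (𝓡 4) 𝓘(ℝ, ℂ) π y)) →
      {y | y ∈ N ∧ π y = 0} = range u₀ ∪ {v₀ 0} →
      ContMDiff 𝓘(ℝ, ℂ) (𝓡 4) ∞ u → ContMDiff 𝓘(ℝ, ℂ) (𝓡 4) ∞ v → (∀ z : ℂ, z ≠ 0 → v z = u z⁻¹) →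
      IsJHolomorphic (𝓡 4) (fun y => JX y) u → IsJHolomorphic (𝓡 4) (fun y => JX y) v →
      Injective u → (∀ z, Injective (mfderiv 𝓘(ℝ, ℂ) (𝓡 4) u z)) →
      Injective (mfderiv 𝓘(ℝ, ℂ) (𝓡 4) v 0) → v 0 ∉ range u →
      (∀ p, CoordNeZero 0 p → F p = u (affineCoordComplex 0 p 0)) →
      (∀ p, CoordNeZero 1 p → F p = v (affineCoordComplex 1 p 0)) →
      (∀ p, CoordNeZero 0 p → F₀ p = u₀ (affineCoordComplex 0 p 0)) →
      (∀ p, CoordNeZero 1 p → F₀ p = v₀ (affineCoordComplex 1 p 0)) →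
      F.Homotopic F₀ →
      ∃ (N' : Set X) (π' : X → ℂ), IsOpen N' ∧ range u ∪ {v 0} ⊆ N' ∧
        ContMDiffOn (𝓡 4) 𝓘(ℝ, ℂ) ∞ π' N' ∧ (∀ y ∈ N', Surjective (mfderiv (𝓡 4) 𝓘(ℝ, ℂ) π' y)) ∧
        {y | y ∈ N' ∧ π' y = 0} = range u ∪ {v 0} :=
  fun X _ _ _ _ _ JX u₀ v₀ N π u v F F₀ hu₀s hv₀s hglue₀ _ _ hu₀inj hu₀imm hv₀imm hv₀notin hNopen hNsub
      hπs hπsurj hzero hus hvs hglue _ _ huinj huimm hvimm hvnotin hFu hFv hF₀u hF₀v hhom =>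
    hN X JX u₀ v₀ N π u v F F₀ hu₀s hv₀s hglue₀ hu₀inj hu₀imm hv₀imm hv₀notin hNopen hNsub hπs hπsurj
      hzero hus hvs hglue huinj huimm hvimm hvnotin hFu hFv hF₀u hF₀v hhom

/-- **`C2J` from adjunction** (`adjunction_embedded_of_somewhereInjective_sphere` = crux
`AdjunctionEmbeddedSpheres`, stmt-16775): an embedded `C` is somewhere injective at `z₀ = 0`; keep
the witness half of the conclusion. -/
theorem helper_nwtJ_of_adjunction
    (hadj : Literature.Geometry.Symplectic.adjunction_embedded_of_somewhereInjective_sphere) :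
    ∀ (X : Type) [TopologicalSpace X] [T2Space X] [SecondCountableTopology X]
      [ChartedSpace (EuclideanSpace ℝ (Fin 4)) X] [IsManifold (𝓡 4) ∞ X]
      (JX : AlmostComplexStructure (𝓡 4) ∞ X) (u₀ v₀ : ℂ → X) (N : Set X) (π : X → ℂ)
      (u v : ℂ → X) (F F₀ : C(ComplexProjectiveSpace 1, X)),
      ContMDiff 𝓘(ℝ, ℂ) (𝓡 4) ∞ u₀ → ContMDiff 𝓘(ℝ, ℂ) (𝓡 4) ∞ v₀ → (∀ z : ℂ, z ≠ 0 → v₀ z = u₀ z⁻¹) →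
      IsJHolomorphic (𝓡 4) (fun y => JX y) u₀ → IsJHolomorphic (𝓡 4) (fun y => JX y) v₀ →
      Injective u₀ → (∀ z, Injective (mfderiv 𝓘(ℝ, ℂ) (𝓡 4) u₀ z)) →
      Injective (mfderiv 𝓘(ℝ, ℂ) (𝓡 4) v₀ 0) → v₀ 0 ∉ range u₀ →
      IsOpen N → range u₀ ∪ {v₀ 0} ⊆ N → ContMDiffOn (𝓡 4) 𝓘(ℝ, ℂ) ∞ π N →
      (∀ y ∈ N, Surjective (mfderiv (𝓡 4) 𝓘(ℝ, ℂ) π y)) →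
      {y | y ∈ N ∧ π y = 0} = range u₀ ∪ {v₀ 0} →
      ContMDiff 𝓘(ℝ, ℂ) (𝓡 4) ∞ u → ContMDiff 𝓘(ℝ, ℂ) (𝓡 4) ∞ v → (∀ z : ℂ, z ≠ 0 → v z = u z⁻¹) →
      IsJHolomorphic (𝓡 4) (fun y => JX y) u → IsJHolomorphic (𝓡 4) (fun y => JX y) v →
      Injective u → (∀ z, Injective (mfderiv 𝓘(ℝ, ℂ) (𝓡 4) u z)) →
      Injective (mfderiv 𝓘(ℝ, ℂ) (𝓡 4) v 0) → v 0 ∉ range u →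
      (∀ p, CoordNeZero 0 p → F p = u (affineCoordComplex 0 p 0)) →
      (∀ p, CoordNeZero 1 p → F p = v (affineCoordComplex 1 p 0)) →
      (∀ p, CoordNeZero 0 p → F₀ p = u₀ (affineCoordComplex 0 p 0)) →
      (∀ p, CoordNeZero 1 p → F₀ p = v₀ (affineCoordComplex 1 p 0)) →
      F.Homotopic F₀ →
      ∃ (N' : Set X) (π' : X → ℂ), IsOpen N' ∧ range u ∪ {v 0} ⊆ N' ∧
        ContMDiffOn (𝓡 4) 𝓘(ℝ, ℂ) ∞ π' N' ∧ (∀ y ∈ N', Surjective (mfderiv (𝓡 4) 𝓘(ℝ, ℂ) π' y)) ∧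
        {y | y ∈ N' ∧ π' y = 0} = range u ∪ {v 0} :=
  fun X _ _ _ _ _ JX u₀ v₀ N π u v F F₀ hu₀s hv₀s hglue₀ hJu₀ hJv₀ hu₀inj hu₀imm hv₀imm hv₀notin hNopen
      hNsub hπs hπsurj hzero hus hvs hglue hJu hJv huinj huimm _ hvnotin hFu hFv hF₀u hF₀v hhom =>
    (hadj X JX u₀ v₀ N π u v F F₀ hu₀s hv₀s hglue₀ hJu₀ hJv₀ hu₀inj hu₀imm hv₀imm hv₀notin hNopen hNsub
      hπs hπsurj hzero hus hvs hglue hJu hJv hFu hFv hF₀u hF₀v hhom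
      ⟨0, huimm 0, fun _ hz => huinj hz, fun h => hvnotin ⟨0, h.symm⟩⟩).2

/-- **The crux from the two route items `LocalFoliationEmbeddedSpheres` (16778) and
`NormalWitnessTransfer` (18059)** — registered helper `helper_witnessCharge_of_hls_nwt`. -/
theorem helper_witnessCharge_of_hls_nwt :
    Summit.SmoothPoincare4.SmoothPoincare4.Theses.SullivanDual.LocalFoliationEmbeddedSpheres →
    Summit.SmoothPoincare4.SmoothPoincare4.Theses.SullivanDual.NormalWitnessTransfer →
    Summit.SmoothPoincare4.SmoothPoincare4.Theses.SullivanDual.WitnessCharge :=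
  fun hL hN => helper_witnessCharge_of_hls_nwtJ hL (helper_nwtJ_of_normalWitnessTransfer hN)

/-- **The crux from HLS and adjunction alone** (v16 `helper_witnessCharge_of_symplecticCapFacts`
with F5 discharged). -/
theorem helper_witnessCharge_of_hls_adj :
    Literature.Geometry.Symplectic.hls_localFoliation_embeddedSphere_trivialNormal →
    Literature.Geometry.Symplectic.adjunction_embedded_of_somewhereInjective_sphere →
    Summit.SmoothPoincare4.SmoothPoincare4.Theses.SullivanDual.WitnessCharge :=
  fun hls hadj => helper_witnessCharge_of_hls_nwtJ hls (helper_nwtJ_of_adjunction hadj)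

/-- **The support item `PencilLocalFamily` (stmt-16772) from HLS and `C2J`**: for ANY compact smooth
4-manifold homotopy equivalent to `S⁴` (orientable by `isOrientable_of_homotopyEquiv_sphere_four_holds`,
hence a `HomotopySphere 4`), the route's inlined member predicate being `IsPencilMember` by `rfl`;
`helper_localFamilyUniv_of_hls_nwtJ` verbatim. -/
theorem helper_pencilLocalFamily_of_hls_nwtJ
    (hls : Literature.Geometry.Symplectic.hls_localFoliation_embeddedSphere_trivialNormal)
    (hnwt : ∀ (X : Type) [TopologicalSpace X] [T2Space X] [SecondCountableTopology X]
      [ChartedSpace (EuclideanSpace ℝ (Fin 4)) X] [IsManifold (𝓡 4) ∞ X]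
      (JX : AlmostComplexStructure (𝓡 4) ∞ X) (u₀ v₀ : ℂ → X) (N : Set X) (π : X → ℂ)
      (u v : ℂ → X) (F F₀ : C(ComplexProjectiveSpace 1, X)),
      ContMDiff 𝓘(ℝ, ℂ) (𝓡 4) ∞ u₀ → ContMDiff 𝓘(ℝ, ℂ) (𝓡 4) ∞ v₀ → (∀ z : ℂ, z ≠ 0 → v₀ z = u₀ z⁻¹) →
      IsJHolomorphic (𝓡 4) (fun y => JX y) u₀ → IsJHolomorphic (𝓡 4) (fun y => JX y) v₀ →
      Injective u₀ → (∀ z, Injective (mfderiv 𝓘(ℝ, ℂ) (𝓡 4) u₀ z)) →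
      Injective (mfderiv 𝓘(ℝ, ℂ) (𝓡 4) v₀ 0) → v₀ 0 ∉ range u₀ →
      IsOpen N → range u₀ ∪ {v₀ 0} ⊆ N → ContMDiffOn (𝓡 4) 𝓘(ℝ, ℂ) ∞ π N →
      (∀ y ∈ N, Surjective (mfderiv (𝓡 4) 𝓘(ℝ, ℂ) π y)) →
      {y | y ∈ N ∧ π y = 0} = range u₀ ∪ {v₀ 0} →
      ContMDiff 𝓘(ℝ, ℂ) (𝓡 4) ∞ u → ContMDiff 𝓘(ℝ, ℂ) (𝓡 4) ∞ v → (∀ z : ℂ, z ≠ 0 → v z = u z⁻¹) →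
      IsJHolomorphic (𝓡 4) (fun y => JX y) u → IsJHolomorphic (𝓡 4) (fun y => JX y) v →
      Injective u → (∀ z, Injective (mfderiv 𝓘(ℝ, ℂ) (𝓡 4) u z)) →
      Injective (mfderiv 𝓘(ℝ, ℂ) (𝓡 4) v 0) → v 0 ∉ range u →
      (∀ p, CoordNeZero 0 p → F p = u (affineCoordComplex 0 p 0)) →
      (∀ p, CoordNeZero 1 p → F p = v (affineCoordComplex 1 p 0)) →
      (∀ p, CoordNeZero 0 p → F₀ p = u₀ (affineCoordComplex 0 p 0)) →
      (∀ p, CoordNeZero 1 p → F₀ p = v₀ (affineCoordComplex 1 p 0)) →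
      F.Homotopic F₀ →
      ∃ (N' : Set X) (π' : X → ℂ), IsOpen N' ∧ range u ∪ {v 0} ⊆ N' ∧
        ContMDiffOn (𝓡 4) 𝓘(ℝ, ℂ) ∞ π' N' ∧ (∀ y ∈ N', Surjective (mfderiv (𝓡 4) 𝓘(ℝ, ℂ) π' y)) ∧
        {y | y ∈ N' ∧ π' y = 0} = range u ∪ {v 0}) :
    Summit.SmoothPoincare4.SmoothPoincare4.Theses.SullivanDual.PencilLocalFamily := by
  intro M _ _ _ _ _ _ hhe p J ε' hε' hball hJ2 hJsm hJstd
  obtain ⟨e⟩ := hhe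
  obtain ⟨o⟩ := isOrientable_of_homotopyEquiv_sphere_four_holds M e
  exact helper_localFamilyUniv_of_hls_nwtJ hls hnwt ⟨M, o, ⟨e⟩⟩ p J ε' hε' hball hJ2 hJsm hJstd

/-- **`PencilLocalFamily` (16772) from the two route items 16778 and 18059** — the common proof term
of the glue items `PencilLocalFamilyOfNormalTransfer` (18051) and `Assembly2` (18038). -/
theorem helper_pencilLocalFamily_of_hls_nwt :
    Summit.SmoothPoincare4.SmoothPoincare4.Theses.SullivanDual.LocalFoliationEmbeddedSpheres →
    Summit.SmoothPoincare4.SmoothPoincare4.Theses.SullivanDual.NormalWitnessTransfer →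
    Summit.SmoothPoincare4.SmoothPoincare4.Theses.SullivanDual.PencilLocalFamily :=
  fun hL hN => helper_pencilLocalFamily_of_hls_nwtJ hL (helper_nwtJ_of_normalWitnessTransfer hN)

end Summit.SmoothPoincare4.SmoothPoincare4.Theorems.WitnessCharge.PencilIncompleteness
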